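import Summits.QuantumFields.YangMills.Theorems.FluctuationComparisonRegPrIntLS2BetaFaceDiscrepancyStage
import Summits.QuantumFields.YangMills.Theorems.FluctuationComparisonRegPrIntLS2BetaCentralFaceDiscrepancyDock
import HarnessLib

/-!
# S2β · Q11j — THE FACE DISCREPANCY LETTER `hface` OF THE PER-`B` ROW FROM FOUR NAMED LETTERS (`ρκ`, `aκ`, `mR`, `ρ̃`): Q11i ∘ px20's central dock, ONE `exact`
# (`SU(2)`, the block-averaging family `blockAvg ℰ`, abstract `wt`∕`lift`∕`g`∕`g₀` under (T4)∕(T5); the face column of the one-profile row closed BY ONE NAME)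

Cell `ym3-torus` (rung R3 = continuum `SU(2)` YM₃ on T³ at fixed lattice data — NOT d = 4, NOT infinite volume, NOT a mass gap, NOT Clay).  Width seat `ym3-torus-px5` (gen 23);
crux `stmt-QuantumFields-20520`, LINE g18-1 S2β; the one-profile LIFT-LADDER″ row.  ✓p833084 `sq_pi_norm_trunc_le_perBlock` (per-`B` row) takes `hface`; ✓p834123 `hface_of_central` reduces
it to px20 g24's CENTRAL letter `hC` + `ρ̃`; ✓p834378 `central_hC_of_letters` (px20) supplies `hC` from `ρκ` (RELATIVE (0.4)-correction ratio), `aκ` (absolute correction factor), `mR`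
(relative lift at the central bond).  THIS FILE is the composition: **`hface` ⟸ {`hκrel`, `hκabs`, `hR`, `hρ̃`}** with
`sF := (π∕2)·((ρκ + 2·aκ·(((L−1)∕2 + 1)·mR)) + ((d−1)·((L−1)∕2))·(1 + 2·((L−1)∕2))·ρ̃)`.  `--kind proof --supports stmt-QuantumFields-20520 --as helper`, count-neutral, DEFINITION-FREE
(0 `def`, 0 `instance`, 0 `notation`, 0 `sorry`, default heartbeats).

WHAT IS PROVED (sorry-free).  ★★★`hface_of_letters` — the `hface` binder of ✓p833084 VERBATIM (at `av := fun i => blockAvg ℰ`) from the four letters on the `pS`-bonds that cross a face.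

HONEST SCOPE.  A junction of two landed lemmas; nothing of Bałaban's analysis is asserted or proved; `ρκ`∕`aκ`∕`mR`∕`ρ̃`, (T4)∕(T5), `hcomm`, the arc profile, READ′, budgets are HYPOTHESES
or others'; rows UNDISCHARGED at the tower; (ST″)∕LOC″, «MULT♭-ax»∕«CRIT-ax», (D-stage), h3, GAP♯∘ (`stub_uniformFibreGapOrbit`, registry 3732b7df UNTOUCHED, 0∕5), S2β, the five registered
stubs, 20520, 19936, 19200, `YM3TorusSU2` NOT proved; no summit statement is proved by a helper; rung R3 — NOT d = 4, NOT infinite volume, NOT a mass gap, NOT Clay; the Yang–Mills mass gap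
is NOT proved.

References: T. Bałaban, CMP **109** (1987) 249–301 [Balaban1987RG1] ((0.3)–(0.4) p.252); CMP **102** (1985) 277–309 [Balaban1985RegularSpaces] ((1.19) p.79); CMP **122** (1989) 355–392
[Balaban1989LargeFieldII] (p.382).
-/

set_option autoImplicit false

namespace Summit.QuantumFields.YangMills.Theorems.FluctuationComparisonRegPrIntLS2BetaFaceDiscrepancyOfLetters

open scoped Real
open Literature.MathematicalPhysics.QuantumLattice (su2Quat)
open Literature.MathematicalPhysics.QuantumFieldTheory.Balaban1983to89
open Literature.MathematicalPhysics.QuantumFieldTheory.Balaban1983to89.T4Continuum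
open Literature.MathematicalPhysics.QuantumFieldTheory.Balaban1983to89.BlockAveraging
open Literature.MathematicalPhysics.QuantumFieldTheory.Balaban1983to89.AveragingRT
open Literature.MathematicalPhysics.QuantumFieldTheory.Balaban1983to89.B10Eq47AxialChi
open B10Eq27TorusAxialLog (rel transl axialT)
open T4CubeChartGnomonic (SU2)
open T4HaarSU2ExpChart (expPoint)
open T4ExpWindowSmallField (logVec)
open Summit.QuantumFields.YangMills.Theorems.FluctuationComparisonRegPrIntLS2BetaFaceDiscrepancyStage (hface_of_central)
open Summit.QuantumFields.YangMills.Theorems.FluctuationComparisonRegPrIntLS2BetaCentralFaceDiscrepancyDock (central_hC_of_letters)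

variable {P : Params}

/-- ★★★ **THE FACE DISCREPANCY LETTER FROM FOUR NAMED LETTERS**: on the `pS`-bonds that cross a face, from `ρκ` (relative correction ratio), `aκ` (absolute correction factor), `mR` (relative lift at
the central bond) and `ρ̃` (relative plaquettes of `(W_t, W̃)` in the bond's block and its neighbour):
`‖logVec (su2Quat (R_b⁻¹·η_b))‖ ≤ (π∕2)·((ρκ + 2·aκ·(((L−1)∕2 + 1)·mR)) + ((d−1)·((L−1)∕2))·(1 + 2·((L−1)∕2))·ρ̃)` — the `hface` binder of ✓p833084 VERBATIM.
[cite: Balaban1987RG1, (0.3)-(0.4) p.252; Balaban1985RegularSpaces, (1.19) p.79; Balaban1989LargeFieldII, p.382] -/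
theorem hface_of_letters (ℰ : LoopAverage SU2) {j : ℕ} (hj : j + 1 ≤ P.m + P.K)
    (wt : (i : ℕ) → PBond P i → PBond P (i + 1) → ℝ) (lift : (i : ℕ) → GaugeField P (i + 1) SU2 → GaugeField P i SU2)
    (g g₀ : (i : ℕ) → Site P i → SU2) (U U₁ : GaugeField P 0 SU2)
    (hwt : ∀ b e, wt j b e = if e.dir = b.dir ∧ (b.src b.dir - emb e.src b.dir).val < P.L then
      ∏ ν ∈ Finset.univ.erase b.dir, max 0 (1 - ((rel (emb e.src) b.src ν).natAbs : ℝ) / P.L) else 0)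
    (hlift : ∀ (X : GaugeField P (j + 1) SU2) (b : PBond P j), lift j X b = expPoint (∑ e, wt j b e • ((P.L : ℝ)⁻¹ • logVec (su2Quat (X e)))))
    (hT4 : ∀ x, axialT (GaugeField.gaugeAct (g j) (Averaging.iter (fun i => blockAvg (P := P) (j := i) ℰ) j U)) (emb (blockOf x)) x =
      axialT (lift j (GaugeField.gaugeAct (g (j + 1)) (Averaging.iter (fun i => blockAvg (P := P) (j := i) ℰ) (j + 1) U))) (emb (blockOf x)) x)
    (hT4' : ∀ x, axialT (GaugeField.gaugeAct (g₀ j) (Averaging.iter (fun i => blockAvg (P := P) (j := i) ℰ) j U₁)) (emb (blockOf x)) x =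
      axialT (lift j (GaugeField.gaugeAct (g₀ (j + 1)) (Averaging.iter (fun i => blockAvg (P := P) (j := i) ℰ) (j + 1) U₁))) (emb (blockOf x)) x)
    (hT5 : (blockAvg (P := P) (j := j) ℰ).avg (GaugeField.gaugeAct (g j) (Averaging.iter (fun i => blockAvg (P := P) (j := i) ℰ) j U)) =
      GaugeField.gaugeAct (g (j + 1)) (Averaging.iter (fun i => blockAvg (P := P) (j := i) ℰ) (j + 1) U))
    (hT5' : (blockAvg (P := P) (j := j) ℰ).avg (GaugeField.gaugeAct (g₀ j) (Averaging.iter (fun i => blockAvg (P := P) (j := i) ℰ) j U₁)) =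
      GaugeField.gaugeAct (g₀ (j + 1)) (Averaging.iter (fun i => blockAvg (P := P) (j := i) ℰ) (j + 1) U₁))
    (hcomm : ∀ x y : SU2, dist1 (x * y * x⁻¹ * y⁻¹) ≤ 2 * dist1 x * dist1 y)
    (pS : PBond P j → Prop) {ρκ aκ mR ρt : ℝ} (hmR : 0 ≤ mR) (hρ0 : 0 ≤ ρt)
    (hκrel : ∀ b : PBond P j, pS b → blockOf (b.src.shift b.dir) ≠ blockOf b.src →
      dist1 (corr ℰ (GaugeField.gaugeAct (g j) (Averaging.iter (fun i => blockAvg (P := P) (j := i) ℰ) j U)) ⟨blockOf b.src, b.dir⟩ *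
        (corr ℰ (GaugeField.gaugeAct (g₀ j) (Averaging.iter (fun i => blockAvg (P := P) (j := i) ℰ) j U₁)) ⟨blockOf b.src, b.dir⟩)⁻¹) ≤ ρκ)
    (hκabs : ∀ b : PBond P j, pS b → blockOf (b.src.shift b.dir) ≠ blockOf b.src →
      dist1 (corr ℰ (GaugeField.gaugeAct (g₀ j) (Averaging.iter (fun i => blockAvg (P := P) (j := i) ℰ) j U₁)) ⟨blockOf b.src, b.dir⟩) ≤ aκ)
    (hR : ∀ b : PBond P j, pS b → blockOf (b.src.shift b.dir) ≠ blockOf b.src →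
      dist1 (lift j (GaugeField.gaugeAct (g (j + 1)) (Averaging.iter (fun i => blockAvg (P := P) (j := i) ℰ) (j + 1) U))
            ⟨transl (emb (blockOf b.src)) (fun ν => if ν = b.dir then (((P.L - 1) / 2 : ℕ) : ℤ) else 0), b.dir⟩ *
          (lift j (GaugeField.gaugeAct (g₀ (j + 1)) (Averaging.iter (fun i => blockAvg (P := P) (j := i) ℰ) (j + 1) U₁))
            ⟨transl (emb (blockOf b.src)) (fun ν => if ν = b.dir then (((P.L - 1) / 2 : ℕ) : ℤ) else 0), b.dir⟩)⁻¹) ≤ mR)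
    (hρ : ∀ (b : PBond P j), pS b → ∀ q : Plaq P j, (blockOf q.src = blockOf b.src ∨ blockOf q.src = (blockOf b.src).shift b.dir) →
      dist1 ((GaugeField.plaqHol (fun b => lift j (GaugeField.gaugeAct (g (j + 1)) (Averaging.iter (fun i => blockAvg (P := P) (j := i) ℰ) (j + 1) U)) b *
            (lift j (GaugeField.gaugeAct (g₀ (j + 1)) (Averaging.iter (fun i => blockAvg (P := P) (j := i) ℰ) (j + 1) U₁)) b)⁻¹ *
          GaugeField.gaugeAct (g₀ j) (Averaging.iter (fun i => blockAvg (P := P) (j := i) ℰ) j U₁) b : GaugeField P j SU2) q)⁻¹ *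
        GaugeField.plaqHol (GaugeField.gaugeAct (g j) (Averaging.iter (fun i => blockAvg (P := P) (j := i) ℰ) j U)) q) ≤ ρt) :
    ∀ b : PBond P j, pS b → blockOf (b.src.shift b.dir) ≠ blockOf b.src →
      ‖logVec (su2Quat ((lift j (GaugeField.gaugeAct (g (j + 1)) (Averaging.iter (fun i => blockAvg (P := P) (j := i) ℰ) (j + 1) U)) b *
          (lift j (GaugeField.gaugeAct (g₀ (j + 1)) (Averaging.iter (fun i => blockAvg (P := P) (j := i) ℰ) (j + 1) U₁)) b)⁻¹)⁻¹ *
        (GaugeField.gaugeAct (g j) (Averaging.iter (fun i => blockAvg (P := P) (j := i) ℰ) j U) b *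
          (GaugeField.gaugeAct (g₀ j) (Averaging.iter (fun i => blockAvg (P := P) (j := i) ℰ) j U₁) b)⁻¹)))‖ ≤
        π / 2 * ((ρκ + 2 * aκ * ((((P.L - 1) / 2 + 1 : ℕ) : ℝ) * mR)) +
          (((P.d - 1) * ((P.L - 1) / 2) : ℕ) : ℝ) * ((1 + 2 * (((P.L - 1) / 2 : ℕ) : ℝ)) * ρt)) :=
  hface_of_central (fun i => blockAvg (P := P) (j := i) ℰ) hj lift g g₀ U U₁ hT4 hT4' pS hρ0 hρ
    (central_hC_of_letters ℰ hj wt lift g g₀ U U₁ hwt hlift hT4 hT4' hT5 hT5' hcomm pS hmR hκrel hκabs hR)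

end Summit.QuantumFields.YangMills.Theorems.FluctuationComparisonRegPrIntLS2BetaFaceDiscrepancyOfLetters
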